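import Summits.QuantumFields.BalabanUV.T4Continuum.Support.VariationalColourTaxiTowerEnd
import Summits.QuantumFields.BalabanUV.T4Continuum.Support.VariationalVectorEndClass
import Mathlib.Analysis.SpecificLimits.Basic

/-!
# T⁴ programme, spine node NE2 (U1a), lane P2 — «V-COL-TAXI-END», companion: THE SMALLNESS ∕ UNIFORMITY ∕ DECAY LINES OF THE TAXI-DATA END UNDER THE
# SCALE-INVARIANT PLAQUETTE CLASS `(L^{k+1})²·b_k ≤ c` — every smallness is a polynomial condition on the field-strength class constant `c`, none on the gauge;
# the V-UB constant is k-UNIFORM; the curl-Federbush parameter decays like `L^{−k}`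

NE2 formalisation swarm `b2b-balaban-t4-ne2-formalise-*`, leaf prover 04 GEN 5 (`prover-b2b-balaban-t4-ne2-formalise-leaf-04-g5-0`); register row «P2-sup» of
`t4/formal/NE2/LEAVES.md`; journal CLAIMS.log «V-COL-TAXI-END».  On top of this lineage's `towerLimitRate_effV_taxiTower_slice` (`VariationalColourTaxiTowerEnd`), part 10's
`Rlev_plaq_succ` ∕ `Rlev_plaq_zero` (p223104), leaf-03-g4's `VectorBlockTrialForm.kappaV_bounds` (p218278 lineage) and leaf-10-g3's `VariationalVectorEndOfLeaves.deltaFV_level_le`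
(p222241) — BY NAME; real arithmetic only, nothing defined.

THE CLASS.  One-step bond operators `R′ k` on the level-`k+1` lattice (spacing `L^{−(k+1)}` in unit-block units) have plaquette defects `b k` with `(L^{k+1})²·b_k ≤ c` —
the lattice field strength is `O(c)` in physical units at every level ([Balaban1985BackgroundPropagators] (3.35) SHAPE for the plaquette variables; `c` is DATA).  The level-`k`
defects of `Rlev k` are then `a_{k+1} = b_k`, `a_0 ≤ L²b_0` (part 10 §1b), so `(L^k)²·a_k ≤ c` as well.
 * §1 arithmetic under the class (`2 ≤ L`, `1 ≤ d`): `kappaV_inv_le` (`κ_n⁻¹ ≤ 60·6^{d−1}`, from `kappaV_bounds`); `runDefect_le_of_class`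
   (`L(L^q−1)(L−1)·b_q ≤ c·(1∕2)^q`); `sumDefect_le_of_class` (`Σ_{q<k} ((d−1)+d²)·L(L^q−1)(L−1)·b_q ≤ 2((d−1)+d²)·c`, `sum_geometric_two_le`); `levelDefect_le_of_class` ∕
   `blockDefect_le_of_class` (`3(d−1)L^k(L^k−1)a_k ≤ 3(d−1)c`, `L^k(d−1)(L^k−1)a_k ≤ (d−1)c` once `(L^k)²a_k ≤ c`) — so `γ_k ≤ (2((d−1)+d²) + 3(d−1))·c`; `lamV_mono`;
   **`LambdaV_le_of_class`** (`Λ_k ≤ 4·lamV d ((d−1)c) C_G⋆ c₀` once `κ⁻¹γ_k ≤ ½`); `deltaCurl_le_of_class` (`δ_k ≤ 2d(d·c + L·c)·θ^k` for `L⁻¹ ≤ θ`).  The level defects are NOT a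
   `def`: inside §2's proof they are the anonymous `Nat.rec (L²b_0) (fun q _ ↦ b_q)` with `Rlev_plaq_zero` ∕ `Rlev_plaq_succ` (part 10 §1b), in the same class.
 * §2 **`towerLimitRate_effV_taxiTower_slice_of_class`** — THE END AT TAXI DATA UNDER THE CLASS: the four per-level smallness lines, the V-UB uniformity and the
   curl-Federbush decay of `towerLimitRate_effV_taxiTower_slice` DISCHARGED from `(L^{k+1})²·b_k ≤ c`, `(L^k)²·C₀,k ≤ c₀`, `C_G,k ≤ C_G⋆` and THREE polynomial smallness
   conditions on `c` (`60·6^{d−1}·(2((d−1)+d²) + 3(d−1))·c ≤ ½`, `2d((d−1)c)² ≤ ½`, `64(2((d−1)+d²)c)² ≤ 1`); the level defects `a k` ELIMINATED (computed from `b`); rate any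
   `θ ∈ [L⁻¹, 1)`; constant `C⋆ = eV Λ⋆ C_P⋆ c_δ + c_σ′(Λ⋆ + eV Λ⋆ C_P⋆ c_δ) + c_σ(C_P⋆(Λ⋆+1)) + ePV Λ⋆ C_P⋆ C_R⋆ c_ε c_δ′` with `Λ⋆ = 4·lamV d ((d−1)c) C_G⋆ c₀`,
   `C_P⋆ = max(40κ⋆, 64 + 40κ′⋆)`, `c_δ = 2d(d·c + L·c)`.  STILL DISPLAYED (honestly): the G-side (V-GF: matrix form, `Gtr`, (GF1′) constants `C_G,k`, `C₀,k`, Gårding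
   `κ_k`, `κ′_k`, SLICE `σ`, `σ′` with decay), V-ONE for the full fine form, V-REG.
WHAT IS NOT HERE: any G-side law (V-GF OPEN); V-ONE (full fine form) and V-REG at the tower's carriers.

HONEST FRAMING (T4-DAG p. 1).  Real arithmetic + composition at MODEL level (`E = ℂ`; bond operators DATA; taxi ∕ straight contours OURS; SHAPES only, no B0, c5); nothing
printed is a hypothesis; no `def`, no `def … : Prop`, no `sorry`; axioms standard.  V-GF ∕ V-ONE ∕ V-REG DISPLAYED ⟹ V-END NOT proved; NE2 NOT proved on either road; NE3
OPEN; spine PROVED 0∕9 unchanged; rung (B)+1 finite T⁴ — NOT infinite volume, NOT mass gap, NOT Clay.  HONEST DEPENDENCY (cell, verbatim): continuum YM on T⁴ ⇐ BetaPertH ∧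
nine spine estimates (0/9 proved); BetaPertH ⇐ (D1) ∧ (D4) ∧ CAP+tail; G-an2-4 gates asym, D1 and NE2/3/4.
-/

noncomputable section

namespace Summit.QuantumFields.BalabanUV.T4Continuum.VariationalColourTaxiTransport

open Finset
open scoped Matrix ComplexOrder BigOperators
open Literature.MathematicalPhysics.QuantumFieldTheory.Balaban1983to89.B5Prop11Plancherel (Tor fine unitVec)
open Literature.Analysis.Complex (qform)
open Summit.QuantumFields.BalabanUV.T4Continuum.VariationalTransfer (blockSpin)
open Summit.QuantumFields.BalabanUV.T4Continuum.VariationalColourFederbush (norm_le_one_of_mem_unitary)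
open Summit.QuantumFields.BalabanUV.T4Continuum.VariationalColourTower (Rtrv)
open Summit.QuantumFields.BalabanUV.T4Continuum.VariationalVectorFederbush (lineT)
open Summit.QuantumFields.BalabanUV.T4Continuum.CovariantAveragingTower (TowerLimitRate)
open Summit.QuantumFields.BalabanUV.T4Continuum.VectorBlockTrialForm (nsqV QvL roughV kappaV kappaV_bounds)
open Summit.QuantumFields.BalabanUV.T4Continuum.VariationalVectorForm (ScV SfV qWV lamV lamV_nonneg)
open Summit.QuantumFields.BalabanUV.T4Continuum.VariationalVectorEffective (unc effV)
open Summit.QuantumFields.BalabanUV.T4Continuum.VariationalVectorTower (Gtr QmL)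
open Summit.QuantumFields.BalabanUV.T4Continuum.VariationalVectorEndOfLeaves (eV ePV deltaFV_level_le)

variable {d : ℕ}

/-! ## §1 Arithmetic under the scale-invariant plaquette class -/

section Arith

variable (L : ℕ)

/-- `κ_n⁻¹ ≤ 60·6^{d−1}`, k-uniform (`kappaV_bounds`). [folklore] -/
theorem kappaV_inv_le (hd : 1 ≤ d) {n : ℕ} (hn : 0 < n) : (kappaV d n)⁻¹ ≤ 60 * (6 : ℝ) ^ (d - 1) := by
  obtain ⟨hlo, -⟩ := kappaV_bounds (d := d) hd hn
  have h0 : (0 : ℝ) < ((1 : ℝ) / 6) ^ (d - 1) / 60 := by positivity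
  calc (kappaV d n)⁻¹ ≤ (((1 : ℝ) / 6) ^ (d - 1) / 60)⁻¹ := inv_anti₀ h0 hlo
    _ = 60 * (6 : ℝ) ^ (d - 1) := by rw [one_div, inv_pow, inv_div, div_eq_mul_inv, inv_inv, mul_comm]

/-- ONE RUN DEFECT UNDER THE CLASS: `L·(L^q − 1)·(L − 1)·b_q ≤ c·(1∕2)^q` for `2 ≤ L`, `0 ≤ b_q`, `(L^{q+1})²·b_q ≤ c`. [folklore] -/
theorem runDefect_le_of_class (hL : 2 ≤ L) (q : ℕ) {bq c : ℝ} (hb0 : 0 ≤ bq) (hbc : (((L ^ (q + 1) : ℕ)) : ℝ) ^ 2 * bq ≤ c) :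
    (L : ℝ) * ((L ^ q - 1 : ℕ) : ℝ) * ((L - 1 : ℕ) : ℝ) * bq ≤ c * (1 / 2 : ℝ) ^ q := by
  have hL2 : (2 : ℝ) ≤ L := by exact_mod_cast hL
  have hL0 : (0 : ℝ) < L := by linarith
  have hLq : (1 : ℝ) ≤ (L : ℝ) ^ q := one_le_pow₀ (by linarith)
  have h1 : ((L ^ q - 1 : ℕ) : ℝ) ≤ (L : ℝ) ^ q := by
    rw [Nat.cast_sub (Nat.one_le_pow q L (by omega)), Nat.cast_pow, Nat.cast_one]; linarith
  have h2 : ((L - 1 : ℕ) : ℝ) ≤ L := by rw [Nat.cast_sub (by omega), Nat.cast_one]; linarith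
  have hc0 : (L : ℝ) ^ q * ((L : ℝ) ^ q * (L * L * bq)) ≤ c := by
    have : (((L ^ (q + 1) : ℕ)) : ℝ) ^ 2 * bq = (L : ℝ) ^ q * ((L : ℝ) ^ q * (L * L * bq)) := by push_cast; ring
    linarith
  -- `L·(L^q−1)·(L−1)·b ≤ L^q·(L·L·b) ≤ c∕L^q ≤ c·(1/2)^q`
  have h3 : (L : ℝ) * ((L ^ q - 1 : ℕ) : ℝ) * ((L - 1 : ℕ) : ℝ) * bq ≤ (L : ℝ) ^ q * (L * L * bq) := by
    have := mul_le_mul h1 h2 (Nat.cast_nonneg _) (by positivity)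
    nlinarith [mul_nonneg (mul_nonneg hL0.le hb0) (sub_nonneg.2 this)]
  have hpos : (0 : ℝ) < (L : ℝ) ^ q := by positivity
  have h4 : (L : ℝ) ^ q * (L * L * bq) ≤ c * ((L : ℝ) ^ q)⁻¹ := by
    rw [← div_eq_mul_inv, le_div_iff₀ hpos]; linarith
  have h5 : ((L : ℝ) ^ q)⁻¹ ≤ (1 / 2 : ℝ) ^ q := by
    rw [← inv_pow, one_div]; exact pow_le_pow_left₀ (by positivity) (by rw [inv_le_inv₀ hL0 (by norm_num)]; exact hL2) q
  have hc : 0 ≤ c := le_trans (by positivity) hc0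
  exact h3.trans (h4.trans (mul_le_mul_of_nonneg_left h5 hc))

/-- THE (E_k) SUM UNDER THE CLASS: `Σ_{q<k} ((d−1)+d²)·L(L^q−1)(L−1)·b_q ≤ 2((d−1)+d²)·c` (`sum_geometric_two_le`). [folklore] -/
theorem sumDefect_le_of_class (hL : 2 ≤ L) {b : ℕ → ℝ} {c : ℝ} (hb0 : ∀ q, 0 ≤ b q) (hbc : ∀ q, (((L ^ (q + 1) : ℕ)) : ℝ) ^ 2 * b q ≤ c) (k : ℕ) :
    ∑ q ∈ Finset.range k, ((((d - 1 : ℕ) : ℝ) + (d : ℝ) * d) * (((L : ℝ) * ((L ^ q - 1 : ℕ) : ℝ) * ((L - 1 : ℕ) : ℝ)) * b q))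
      ≤ 2 * ((((d - 1 : ℕ) : ℝ) + (d : ℝ) * d) * c) := by
  have hc : 0 ≤ c := le_trans (by have := hb0 0; positivity) (hbc 0)
  have hD : 0 ≤ (((d - 1 : ℕ) : ℝ) + (d : ℝ) * d) := by positivity
  calc ∑ q ∈ Finset.range k, ((((d - 1 : ℕ) : ℝ) + (d : ℝ) * d) * (((L : ℝ) * ((L ^ q - 1 : ℕ) : ℝ) * ((L - 1 : ℕ) : ℝ)) * b q))
      ≤ ∑ q ∈ Finset.range k, ((((d - 1 : ℕ) : ℝ) + (d : ℝ) * d) * c) * (1 / 2 : ℝ) ^ q := by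
        refine Finset.sum_le_sum fun q _ => ?_
        have h := runDefect_le_of_class L hL q (hb0 q) (hbc q)
        have : ((L : ℝ) * ((L ^ q - 1 : ℕ) : ℝ) * ((L - 1 : ℕ) : ℝ)) * b q ≤ c * (1 / 2 : ℝ) ^ q := by linarith
        nlinarith [mul_le_mul_of_nonneg_left this hD]
    _ = ((((d - 1 : ℕ) : ℝ) + (d : ℝ) * d) * c) * ∑ q ∈ Finset.range k, (1 / 2 : ℝ) ^ q := by rw [Finset.mul_sum]
    _ ≤ ((((d - 1 : ℕ) : ℝ) + (d : ℝ) * d) * c) * 2 := mul_le_mul_of_nonneg_left (sum_geometric_two_le k) (by positivity)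
    _ = _ := by ring

/-- THE LEVEL DEFECT TERM UNDER THE CLASS: `3(d−1)·L^k·(L^k−1)·a_k ≤ 3(d−1)·c` once `(L^k)²·a_k ≤ c`, `0 ≤ a_k`. [folklore] -/
theorem levelDefect_le_of_class (k : ℕ) {ak c : ℝ} (ha0 : 0 ≤ ak) (hac : (((L ^ k : ℕ)) : ℝ) ^ 2 * ak ≤ c) :
    3 * (((d - 1 : ℕ) : ℝ) * (L ^ k : ℕ) * ((L ^ k - 1 : ℕ) : ℝ) * ak) ≤ 3 * (((d - 1 : ℕ) : ℝ) * c) := by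
  have h1 : ((L ^ k - 1 : ℕ) : ℝ) ≤ (((L ^ k : ℕ)) : ℝ) := by exact_mod_cast Nat.sub_le _ _
  have h2 : ((((L ^ k : ℕ)) : ℝ)) * ((L ^ k - 1 : ℕ) : ℝ) * ak ≤ c :=
    le_trans (by nlinarith [mul_nonneg (mul_nonneg (Nat.cast_nonneg (L ^ k)) ha0) (sub_nonneg.2 h1)]) hac
  have hD : 0 ≤ ((d - 1 : ℕ) : ℝ) := Nat.cast_nonneg _
  nlinarith [mul_le_mul_of_nonneg_left h2 hD]

/-- the in-block budget `L^k·((d−1)(L^k−1)a_k) ≤ (d−1)·c` under the class. [folklore] -/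
theorem blockDefect_le_of_class (k : ℕ) {ak c : ℝ} (ha0 : 0 ≤ ak) (hac : (((L ^ k : ℕ)) : ℝ) ^ 2 * ak ≤ c) :
    ((L ^ k : ℕ) : ℝ) * (((d - 1 : ℕ) : ℝ) * ((L ^ k - 1 : ℕ) : ℝ) * ak) ≤ ((d - 1 : ℕ) : ℝ) * c := by
  have h := levelDefect_le_of_class (d := d) L k ha0 hac
  nlinarith

/-- `lamV` is monotone in its three budgets on the nonnegative cone. [folklore] -/
theorem lamV_mono {x x' CG CG' c₀ c₀' : ℝ} (hx : 0 ≤ x) (hx' : x ≤ x') (hCG : 0 ≤ CG) (hCG' : CG ≤ CG') (hc₀ : c₀ ≤ c₀') :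
    lamV d x CG c₀ ≤ lamV d x' CG' c₀' := by
  unfold lamV
  have h1 : (2 + x) ^ 2 + 9 ≤ (2 + x') ^ 2 + 9 := by nlinarith
  have hd0 : (0 : ℝ) ≤ d := Nat.cast_nonneg d
  have h2 : 2 * (d : ℝ) * (2 + CG) * ((2 + x) ^ 2 + 9) ≤ 2 * (d : ℝ) * (2 + CG') * ((2 + x') ^ 2 + 9) :=
    mul_le_mul (by nlinarith) h1 (by positivity) (by have : 0 ≤ CG' := hCG.trans hCG'; positivity)
  exact mul_le_mul_of_nonneg_left (by linarith) (by positivity)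

/-- **THE V-UB CONSTANT IS k-UNIFORM UNDER THE CLASS**: with `0 ≤ x_k ≤ (d−1)c`, `0 ≤ C_G,k ≤ C_G⋆`, `0 ≤ C_k ≤ c₀` and `0 ≤ κ⁻¹γ_k ≤ ½`,
`lamV d x_k C_G,k C_k ∕ (1 − κ⁻¹γ_k)² ≤ 4·lamV d ((d−1)c) C_G⋆ c₀` (only `κ⁻¹γ_k ≤ ½` is used). [folklore] -/
theorem LambdaV_le_of_class {x CG CGs C c₀ t c : ℝ} (hx : 0 ≤ x) (hxc : x ≤ ((d - 1 : ℕ) : ℝ) * c) (hCG : 0 ≤ CG) (hCGs : CG ≤ CGs)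
    (hC0 : 0 ≤ C) (hC : C ≤ c₀) (ht : t ≤ 1 / 2) :
    lamV d x CG C / (1 - t) ^ 2 ≤ 4 * lamV d (((d - 1 : ℕ) : ℝ) * c) CGs c₀ := by
  have hm := lamV_mono (d := d) hx hxc hCG hCGs hC
  have hl0 : 0 ≤ lamV d x CG C := lamV_nonneg hCG hC0
  have hsq : 1 / 4 ≤ (1 - t) ^ 2 := by nlinarith
  rw [div_le_iff₀ (by linarith)]
  nlinarith [mul_le_mul_of_nonneg_left hsq (by linarith : 0 ≤ 4 * lamV d (((d - 1 : ℕ) : ℝ) * c) CGs c₀)]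

/-- **THE CURL-FEDERBUSH PARAMETER DECAYS UNDER THE CLASS**: `δ_k = d·L^k·(2((d−1)L(L−1)b_k + L²b_k) + 2L·L²b_k) ≤ 2d(d·c + L·c)·θ^k` for `L⁻¹ ≤ θ`
(leaf-10-g3's `deltaFV_level_le` with `m_F = ((d−1)L(L−1) + L²)b_k`, `w′ = L²b_k`, `(L^k)²m_F ≤ d·c`, `(L^k)²w′ ≤ c`). [folklore] -/
theorem deltaCurl_le_of_class (hL : 2 ≤ L) (hd : 1 ≤ d) (k : ℕ) {bk c θ : ℝ} (hb0 : 0 ≤ bk) (hbc : (((L ^ (k + 1) : ℕ)) : ℝ) ^ 2 * bk ≤ c)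
    (hθL : (L : ℝ)⁻¹ ≤ θ) :
    (d : ℝ) * ((((L ^ k : ℕ)) : ℝ) * (2 * (((d - 1 : ℕ) : ℝ) * L * ((L - 1 : ℕ) : ℝ) * bk + L * L * bk) + 2 * L * (L * L * bk)))
      ≤ 2 * d * ((d : ℝ) * c + L * c) * θ ^ k := by
  have hL2 : (2 : ℝ) ≤ L := by exact_mod_cast hL
  have hL1 : (1 : ℝ) ≤ L := by linarith
  have hd1 : (1 : ℝ) ≤ d := by exact_mod_cast hd
  have hdm : ((d - 1 : ℕ) : ℝ) = (d : ℝ) - 1 := by rw [Nat.cast_sub hd, Nat.cast_one]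
  have hLm : ((L - 1 : ℕ) : ℝ) ≤ L := by rw [Nat.cast_sub (by omega), Nat.cast_one]; linarith
  have hsq : (((L ^ (k + 1) : ℕ)) : ℝ) ^ 2 = (((L ^ k : ℕ)) : ℝ) ^ 2 * ((L : ℝ) * L) := by push_cast; ring
  have hw : (((L ^ k : ℕ)) : ℝ) ^ 2 * ((L : ℝ) * L * bk) ≤ c := by rw [hsq] at hbc; linarith
  have hmF : (((L ^ k : ℕ)) : ℝ) ^ 2 * (((d - 1 : ℕ) : ℝ) * L * ((L - 1 : ℕ) : ℝ) * bk + L * L * bk) ≤ (d : ℝ) * c := by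
    have h1 : ((d - 1 : ℕ) : ℝ) * L * ((L - 1 : ℕ) : ℝ) * bk ≤ ((d : ℝ) - 1) * ((L : ℝ) * L * bk) := by
      rw [hdm]
      have := mul_le_mul_of_nonneg_left hLm (mul_nonneg (mul_nonneg (by linarith) (by linarith)) hb0 : 0 ≤ ((d : ℝ) - 1) * L * bk)
      nlinarith
    have h0 : 0 ≤ (((L ^ k : ℕ)) : ℝ) ^ 2 := by positivity
    have h2 := mul_le_mul_of_nonneg_left h1 h0
    have hc : (((L ^ k : ℕ)) : ℝ) ^ 2 * ((L : ℝ) * L * bk) ≤ c := hw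
    nlinarith [mul_le_mul_of_nonneg_left hc (by linarith : 0 ≤ (d : ℝ) - 1)]
  have h := deltaFV_level_le (d := d) L hL1 k hmF hw
  have hθk : ((L : ℝ)⁻¹) ^ k ≤ θ ^ k := pow_le_pow_left₀ (by positivity) hθL k
  have hc0 : 0 ≤ c := le_trans (by positivity) hw
  have hK : 0 ≤ 2 * d * ((d : ℝ) * c + L * c) := by positivity
  calc (d : ℝ) * ((((L ^ k : ℕ)) : ℝ) * (2 * (((d - 1 : ℕ) : ℝ) * L * ((L - 1 : ℕ) : ℝ) * bk + L * L * bk) + 2 * L * (L * L * bk)))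
      ≤ 2 * d * ((d : ℝ) * c + L * c) * ((L : ℝ)⁻¹) ^ k := h
    _ ≤ 2 * d * ((d : ℝ) * c + L * c) * θ ^ k := mul_le_mul_of_nonneg_left hθk hK

end Arith

/-! ## §2 THE END AT TAXI DATA UNDER THE SCALE-INVARIANT PLAQUETTE CLASS -/

section End

variable (L : ℕ) [NeZero L] (M : Fin d → ℕ) [hM : ∀ μ, NeZero (M μ)]
variable {R' : (k : ℕ) → Tor (fine L (fine (L ^ k) M)) → Fin d → (ℂ →L[ℂ] ℂ)}
variable (Gm : (k : ℕ) → Matrix (Tor (fine (L ^ k) M) × Fin d) (Tor (fine (L ^ k) M) × Fin d) ℂ)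
variable (G : (k : ℕ) → (Tor (fine (L ^ k) M) → Fin d → ℂ) → ℝ)
variable (G' : (k : ℕ) → (Tor (fine L (fine (L ^ k) M)) → Fin d → ℂ) → ℝ)

/-- **THE VECTOR END OF ROAD P2 AT BAŁABAN's TAXI DATA UNDER THE SCALE-INVARIANT PLAQUETTE CLASS** (gauge-slice variant, transport side inhabited, rate any
`θ ∈ [L⁻¹, 1)`).  DATA: `2 ≤ L`, `1 ≤ d`, `1 < M_μ`; a COHERENT tower of UNITARY one-step bond operators `R′ k` whose plaquette defects obey `(L^{k+1})²·b_k ≤ c` with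
`c` POLYNOMIALLY SMALL (`60·6^{d−1}·(2((d−1)+d²) + 3(d−1))·c ≤ ½`, `2d((d−1)c)² ≤ ½`, `64(2((d−1)+d²)c)² ≤ 1`).  DISCHARGED on top of `towerLimitRate_effV_taxiTower_slice`:
the level defects (`a_{k+1} = b_k`, `a_0 = L²b_0`), the four per-level smallness lines, the V-UB uniformity `Λ_k ≤ Λ⋆ = 4·lamV d ((d−1)c) C_G⋆ c₀`, the curl-Federbush
decay `δ_k ≤ 2d(d·c + L·c)·θ^k`.  DISPLAYED: the G-side (V-GF: matrix form, `Gtr`, (GF1′) with `C_G,k ≤ C_G⋆`, `(L^k)²C₀,k ≤ c₀`, Gårding `κ_k ≤ κ⋆`, `κ′_k ≤ κ′⋆`,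
SLICE with decaying costs), V-ONE for the full fine form, V-REG (`aa` = p221732's parameter `a`). [folklore] -/
theorem towerLimitRate_effV_taxiTower_slice_of_class (hL : 2 ≤ L) (hd : 1 ≤ d) (hM2 : ∀ μ, 1 < M μ)
    -- the one-step bond data: unitary, plaquette class, coherent
    (hU : ∀ k x μ, R' k x μ ∈ unitary (ℂ →L[ℂ] ℂ)) {b : ℕ → ℝ} {c : ℝ}
    (hb : ∀ k x κ ι, ‖R' k x κ * R' k (x + unitVec (fine L (fine (L ^ k) M)) κ) ι - R' k x ι * R' k (x + unitVec (fine L (fine (L ^ k) M)) ι) κ‖ ≤ b k)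
    (hbc : ∀ k, (((L ^ (k + 1) : ℕ)) : ℝ) ^ 2 * b k ≤ c)
    (hcoh : ∀ k, coarseTv L (fine (L ^ (k + 1)) M) (R' (k + 1)) = Rtrv (L ^ k) L M (R' k))
    -- the polynomial smallness of the class constant
    (hsm1 : 60 * (6 : ℝ) ^ (d - 1) * ((2 * ((((d - 1 : ℕ) : ℝ) + (d : ℝ) * d)) + 3 * ((d - 1 : ℕ) : ℝ)) * c) ≤ 1 / 2)
    (hsm2 : 2 * (d : ℝ) * ((((d - 1 : ℕ) : ℝ)) * c) ^ 2 ≤ 1 / 2) (hsm3 : 64 * (2 * ((((d - 1 : ℕ) : ℝ) + (d : ℝ) * d) * c)) ^ 2 ≤ 1)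
    -- the G-side (leaf V-GF, DISPLAYED): matrix form, transport identity, (GF1′) in the class, the Gårding half, the gauge SLICE with decaying costs
    (hGm : ∀ k, (Gm k).PosSemidef) (hG : ∀ k W, G k W = qform (Gm k) (unc W)) (hGtr : ∀ k, G (k + 1) = Gtr (L ^ k) L M (G' k))
    {CG C₀ κg κg' : ℕ → ℝ} {CGs c₀ κs κs' : ℝ} (hCG : ∀ k, 0 ≤ CG k) (hCGs : ∀ k, CG k ≤ CGs) (hC₀ : ∀ k, 0 ≤ C₀ k)
    (hC₀c : ∀ k, (((L ^ k : ℕ)) : ℝ) ^ 2 * C₀ k ≤ c₀) (hκg' : ∀ k, 0 ≤ κg' k) (hκs : ∀ k, κg k ≤ κs) (hκs' : ∀ k, κg' k ≤ κs')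
    (hGF : ∀ k W, G k W ≤ CG k * roughV (L ^ k) M (Rlev L M R' k) W + C₀ k * nsqV (fine (L ^ k) M) W)
    (hGar : ∀ k W, ((((L ^ k : ℕ) : ℝ)) ^ d)⁻¹ * ((((L ^ k : ℕ) : ℝ)) ^ 2 * roughV (L ^ k) M (Rlev L M R' k) W)
      ≤ κg k * ScV (L ^ k) M (Rlev L M R' k) (G k) W + κg' k * nsqV M (QvL (L ^ k) M (nestLv L M R' k) W))
    (σ σ' : ℕ → ℝ) {cσ cσ' : ℝ} (hσ : ∀ k, 0 ≤ σ k) (hσ' : ∀ k, 0 ≤ σ' k)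
    (hslice : ∀ k W, ∃ Ws, QvL (L ^ k) M (nestLv L M R' k) Ws = QvL (L ^ k) M (nestLv L M R' k) W ∧
      ScV (L ^ k) M (Rlev L M R' k) (G k) Ws ≤ ScV (L ^ k) M (Rlev L M R' k) (fun _ => 0) W + σ' k * ScV (L ^ k) M (Rlev L M R' k) (fun _ => 0) W
        + σ k * qWV (L ^ k) M W)
    -- the rate and the decay of the slice costs
    {aa : ℝ} (haa : 0 < aa) {θ : ℝ} (hθL : (L : ℝ)⁻¹ ≤ θ) (hθ1 : θ < 1) (hσθ : ∀ k, σ k ≤ cσ * θ ^ k) (hσ'θ : ∀ k, σ' k ≤ cσ' * θ ^ k)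
    -- leaf V-ONE for the FULL fine form and leaf V-REG (DISPLAYED)
    (CR ε₁ δ' : ℕ → ℝ) {CRs cε cδ' : ℝ} (hCR : ∀ k, 0 ≤ CR k) (hCRs : ∀ k, CR k ≤ CRs) (hε₁ : ∀ k, 0 ≤ ε₁ k) (hδ' : ∀ k, 0 ≤ δ' k)
    (hεθ : ∀ k, ε₁ k ≤ cε * θ ^ k) (hδ'θ : ∀ k, δ' k ≤ cδ' * θ ^ k)
    {ρV : (k : ℕ) → (Tor (fine (L ^ k) M) → Fin d → ℂ) → ℝ} (hρ0 : ∀ k W, 0 ≤ ρV k W)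
    (hONE : ∀ k W, blockSpin (QvL L (fine (L ^ k) M) (lineT L (fine (L ^ k) M) (taxiTv L (fine (L ^ k) M) (R' k)) (R' k))) (SfV (L ^ k) L M (R' k) (G' k)) W
      ≤ (Real.sqrt (ScV (L ^ k) M (Rlev L M R' k) (G k) W + ε₁ k * ρV k W) + δ' k * Real.sqrt (qWV (L ^ k) M W)) ^ 2)
    (hREG : ∀ k (φ : Tor M → Fin d → ℂ) W, QvL (L ^ k) M (nestLv L M R' k) W = φ →
      (∀ W₂, QvL (L ^ k) M (nestLv L M R' k) W₂ = φ → ScV (L ^ k) M (Rlev L M R' k) (G k) W ≤ ScV (L ^ k) M (Rlev L M R' k) (G k) W₂) →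
      ρV k W ≤ CR k * (ScV (L ^ k) M (Rlev L M R' k) (G k) W + nsqV M φ)) :
    TowerLimitRate (ι := fun _ => Tor M × Fin d) (fun _ => (1 : Matrix (Tor M × Fin d) (Tor M × Fin d) ℂ)) 1
      (fun k => effV (L ^ k) M (Rlev L M R' k) (Gm k) (QmL (L ^ k) M (nestLv L M R' k)) aa)
      (eV (4 * lamV d (((d - 1 : ℕ) : ℝ) * c) CGs c₀) (max (40 * κs) (64 + 40 * κs')) (2 * d * ((d : ℝ) * c + L * c))
        + cσ' * (4 * lamV d (((d - 1 : ℕ) : ℝ) * c) CGs c₀ + eV (4 * lamV d (((d - 1 : ℕ) : ℝ) * c) CGs c₀) (max (40 * κs) (64 + 40 * κs')) (2 * d * ((d : ℝ) * c + L * c)))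
        + cσ * (max (40 * κs) (64 + 40 * κs') * (4 * lamV d (((d - 1 : ℕ) : ℝ) * c) CGs c₀ + 1))
        + ePV (4 * lamV d (((d - 1 : ℕ) : ℝ) * c) CGs c₀) (max (40 * κs) (64 + 40 * κs')) CRs cε cδ') θ := by
  have hL2 : (2 : ℝ) ≤ L := by exact_mod_cast hL
  have hL0 : (0 : ℝ) < L := by linarith
  have hθ0 : 0 ≤ θ := le_trans (by positivity) hθL
  have hR' : ∀ k x μ, ‖R' k x μ‖ ≤ 1 := fun k x μ => norm_le_one_of_mem_unitary (hU k x μ)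
  have hb0 : ∀ k, 0 ≤ b k := fun k => (norm_nonneg _).trans (hb k 0 ⟨0, hd⟩ ⟨0, hd⟩)
  have hc0 : 0 ≤ c := le_trans (by have := hb0 0; positivity) (hbc 0)
  -- the level-`k` plaquette defects, computed from the one-step ones (part 10 §1b), in the same class
  obtain ⟨a, ha0, ha, hac⟩ : ∃ a : ℕ → ℝ, (∀ k, 0 ≤ a k) ∧
      (∀ k x κ ι, ‖Rlev L M R' k x κ * Rlev L M R' k (x + unitVec (fine (L ^ k) M) κ) ι - Rlev L M R' k x ι * Rlev L M R' k (x + unitVec (fine (L ^ k) M) ι) κ‖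
        ≤ a k) ∧ (∀ k, (((L ^ k : ℕ)) : ℝ) ^ 2 * a k ≤ c) := by
    refine ⟨fun k => Nat.rec ((L : ℝ) * L * b 0) (fun q _ => b q) k, ?_, ?_, ?_⟩
    · rintro (_ | q)
      · exact (by have := hb0 0; positivity : 0 ≤ (L : ℝ) * L * b 0)
      · exact hb0 q
    · rintro (_ | q) x κ ι
      · exact Rlev_plaq_zero L M hb (hR' 0) x κ ι
      · exact Rlev_plaq_succ L M hb q x κ ι
    · rintro (_ | q)
      · have h := hbc 0
        simp only [zero_add, pow_one] at h
        show (((L ^ 0 : ℕ)) : ℝ) ^ 2 * ((L : ℝ) * L * b 0) ≤ c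
        simp only [pow_zero, Nat.cast_one, one_pow, one_mul]
        nlinarith
      · exact hbc q
  -- the (E_k) sum and the total near-frame budget `γ_k` under the class
  have hS : ∀ k, ∑ q ∈ Finset.range k, ((((d - 1 : ℕ) : ℝ) + (d : ℝ) * d) * (((L : ℝ) * ((L ^ q - 1 : ℕ) : ℝ) * ((L - 1 : ℕ) : ℝ)) * b q))
      ≤ 2 * ((((d - 1 : ℕ) : ℝ) + (d : ℝ) * d) * c) := sumDefect_le_of_class (d := d) L hL hb0 hbc
  have hS0 : ∀ k, 0 ≤ ∑ q ∈ Finset.range k, ((((d - 1 : ℕ) : ℝ) + (d : ℝ) * d) * (((L : ℝ) * ((L ^ q - 1 : ℕ) : ℝ) * ((L - 1 : ℕ) : ℝ)) * b q)) :=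
    fun k => Finset.sum_nonneg fun q _ => by have := hb0 q; positivity
  have hT : ∀ k, 3 * (((d - 1 : ℕ) : ℝ) * (L ^ k : ℕ) * ((L ^ k - 1 : ℕ) : ℝ) * a k) ≤ 3 * (((d - 1 : ℕ) : ℝ) * c) :=
    fun k => levelDefect_le_of_class (d := d) L k (ha0 k) (hac k)
  have hT0 : ∀ k, 0 ≤ 3 * (((d - 1 : ℕ) : ℝ) * (L ^ k : ℕ) * ((L ^ k - 1 : ℕ) : ℝ) * a k) := fun k => by have := ha0 k; positivity
  have hγ : ∀ k, (∑ q ∈ Finset.range k, ((((d - 1 : ℕ) : ℝ) + (d : ℝ) * d) * (((L : ℝ) * ((L ^ q - 1 : ℕ) : ℝ) * ((L - 1 : ℕ) : ℝ)) * b q)))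
      + 3 * (((d - 1 : ℕ) : ℝ) * (L ^ k : ℕ) * ((L ^ k - 1 : ℕ) : ℝ) * a k) ≤ (2 * ((((d - 1 : ℕ) : ℝ) + (d : ℝ) * d)) + 3 * ((d - 1 : ℕ) : ℝ)) * c :=
    fun k => by linarith [hS k, hT k]
  -- `κ⁻¹γ_k ≤ ½` at every level (and at the one-step level `L`)
  have hK : ∀ n : ℕ, 0 < n → (kappaV d n)⁻¹ ≤ 60 * (6 : ℝ) ^ (d - 1) := fun n hn => kappaV_inv_le (d := d) hd hn
  have hLk : ∀ k : ℕ, 0 < L ^ k := fun k => pow_pos (by omega) k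
  have hκγ : ∀ k, (kappaV d (L ^ k))⁻¹ * ((∑ q ∈ Finset.range k, ((((d - 1 : ℕ) : ℝ) + (d : ℝ) * d) * (((L : ℝ) * ((L ^ q - 1 : ℕ) : ℝ) * ((L - 1 : ℕ) : ℝ)) * b q)))
      + 3 * (((d - 1 : ℕ) : ℝ) * (L ^ k : ℕ) * ((L ^ k - 1 : ℕ) : ℝ) * a k)) ≤ 1 / 2 := fun k => by
    have h1 := mul_le_mul (hK (L ^ k) (hLk k)) (hγ k) (add_nonneg (hS0 k) (hT0 k)) (by positivity)
    linarith
  have hκγ0 : ∀ k, 0 ≤ (kappaV d (L ^ k))⁻¹ * ((∑ q ∈ Finset.range k, ((((d - 1 : ℕ) : ℝ) + (d : ℝ) * d) * (((L : ℝ) * ((L ^ q - 1 : ℕ) : ℝ) * ((L - 1 : ℕ) : ℝ)) * b q)))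
      + 3 * (((d - 1 : ℕ) : ℝ) * (L ^ k : ℕ) * ((L ^ k - 1 : ℕ) : ℝ) * a k)) :=
    fun k => mul_nonneg (inv_nonneg.2 (VectorBlockTrialForm.kappaV_pos hd (hLk k)).le) (add_nonneg (hS0 k) (hT0 k))
  -- the one-step smallness at level `L`: `L(L−1)b_k ≤ c`
  have hc1 : ∀ k, (kappaV d L)⁻¹ * (3 * (((d - 1 : ℕ) : ℝ) * L * ((L - 1 : ℕ) : ℝ) * b k)) < 1 := fun k => by
    have hLm : ((L - 1 : ℕ) : ℝ) ≤ L := by rw [Nat.cast_sub (by omega), Nat.cast_one]; linarith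
    have h1 : (L : ℝ) * ((L - 1 : ℕ) : ℝ) * b k ≤ c := by
      have h2 : (L : ℝ) * L * b k ≤ c := by
        have h3 := hbc k
        have h4 : (L : ℝ) * L * b k ≤ (((L ^ (k + 1) : ℕ)) : ℝ) ^ 2 * b k := by
          have : (L : ℝ) * L ≤ (((L ^ (k + 1) : ℕ)) : ℝ) ^ 2 := by
            push_cast
            have : (L : ℝ) ≤ (L : ℝ) ^ (k + 1) := le_self_pow₀ (by linarith) (by omega)
            nlinarith
          exact mul_le_mul_of_nonneg_right this (hb0 k)
        linarith
      nlinarith [mul_le_mul_of_nonneg_left hLm (by have := hb0 k; positivity : 0 ≤ (L : ℝ) * b k)]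
    have h5 : 3 * (((d - 1 : ℕ) : ℝ) * L * ((L - 1 : ℕ) : ℝ) * b k) ≤ 3 * (((d - 1 : ℕ) : ℝ) * c) := by
      nlinarith [mul_le_mul_of_nonneg_left h1 (Nat.cast_nonneg (α := ℝ) (d - 1))]
    have h6 : 3 * (((d - 1 : ℕ) : ℝ) * c) ≤ (2 * ((((d - 1 : ℕ) : ℝ) + (d : ℝ) * d)) + 3 * ((d - 1 : ℕ) : ℝ)) * c := by
      nlinarith [Nat.cast_nonneg (α := ℝ) (d - 1), Nat.cast_nonneg (α := ℝ) d]
    have h7 := mul_le_mul (hK L (by omega)) (h5.trans h6) (by have := hb0 k; positivity) (by positivity)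
    linarith
  refine towerLimitRate_effV_taxiTower_slice L M Gm G G' hd hM2 hU hb ha0 ha hcoh hGm hG hGtr hCG hC₀ hκg' hκs hκs' hGF hGar σ σ' hσ hσ' hslice
    (fun k => lt_of_le_of_lt (hκγ k) (by norm_num)) (fun k => ?_) (fun k => ?_) hc1 haa hθ0 hθ1 (fun k => ?_) (fun k => ?_) hσθ hσ'θ
    CR ε₁ δ' hCR hCRs hε₁ hδ' hεθ hδ'θ hρ0 hONE hREG
  · -- `2d(L^k(d−1)(L^k−1)a_k)² ≤ ½`
    have h := blockDefect_le_of_class (d := d) L k (ha0 k) (hac k)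
    have h0 : 0 ≤ ((L ^ k : ℕ) : ℝ) * (((d - 1 : ℕ) : ℝ) * ((L ^ k - 1 : ℕ) : ℝ) * a k) := by have := ha0 k; positivity
    have h2 : (((L ^ k : ℕ) : ℝ) * (((d - 1 : ℕ) : ℝ) * ((L ^ k - 1 : ℕ) : ℝ) * a k)) ^ 2 ≤ ((((d - 1 : ℕ) : ℝ)) * c) ^ 2 :=
      pow_le_pow_left₀ h0 h 2
    nlinarith [Nat.cast_nonneg (α := ℝ) d]
  · -- `64·S_k² ≤ 1`
    have h2 : (∑ q ∈ Finset.range k, ((((d - 1 : ℕ) : ℝ) + (d : ℝ) * d) * (((L : ℝ) * ((L ^ q - 1 : ℕ) : ℝ) * ((L - 1 : ℕ) : ℝ)) * b q))) ^ 2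
        ≤ (2 * ((((d - 1 : ℕ) : ℝ) + (d : ℝ) * d) * c)) ^ 2 := pow_le_pow_left₀ (hS0 k) (hS k) 2
    linarith
  · -- `Λ_k ≤ Λ⋆`
    exact LambdaV_le_of_class (d := d) (by have := ha0 k; positivity) (blockDefect_le_of_class (d := d) L k (ha0 k) (hac k)) (hCG k) (hCGs k)
      (by have := hC₀ k; positivity) (hC₀c k) (hκγ k)
  · -- `δ_k ≤ c_δ·θ^k`
    exact deltaCurl_le_of_class (d := d) L hL hd k (hb0 k) (hbc k) hθL

end End

end Summit.QuantumFields.BalabanUV.T4Continuum.VariationalColourTaxiTransport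

end
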